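import Mathlib
import Summits.AtomisticToContinuum.Crystallization.Theorems.ExcessDecayLiouvilleCoarseGrainsPinFromSeries

/-!
# Crux `ChessboardParticlePlanes.LjBilayerHcp` (stmt-AtomisticToContinuum-6710), line `Sketch`, stub N2
# `stub_powerSums_antitone` — the inverse-power hcp lattice sums decrease in the parameters

With the planar form `Q(k,i,j) = i² + ij + j² + [k odd](i + j + 1/3)` (the squared planar offset of the hcp
site `(k,i,j)` at unit spacing), the families `v ↦ [v ≠ 0]·((a²Q v + k²h²)⁻¹)ⁿ` over `ℤ³` are termwise
antitone in `(a, h)` on `0 < a`, `0 < h`: `Q v ≥ 0` by the two square completions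
`i² + ij + j² = (i + j/2)² + 3j²/4` and `i² + ij + j² + i + j + 1/3 = (i + j/2 + 1/2)² + (3/4)(j + 1/3)²`,
so the base `a²Q v + k²h²` is nonnegative and monotone in `(a, h)`; inversion reverses the inequality
(when the smaller base vanishes, `Q v = 0` and `k = 0`, so the larger base vanishes too and both inverses
are `0`), and `n`-th powers of nonnegative reals are monotone.  Summability passes to the larger parameters
by domination (`Summable.of_nonneg_of_le`) and `Summable.tsum_le_tsum` compares the sums.  `Q ≥ 0` is the
landed `ExcessDecayLiouvilleCoarseGrains.hcpPinC_Q_nonneg`; otherwise Mathlib only. [folklore]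
-/

noncomputable section

open scoped BigOperators Classical

namespace Summit.AtomisticToContinuum.Crystallization.Theorems.LjBilayerHcpSketch

/-- Termwise comparison behind the antitonicity of the power sums: if `0 ≤ q`, `0 < a₁ ≤ a₂` and
`0 < h₁ ≤ h₂`, then for every real `k` and every `n`,
`0 ≤ ((a₂² q + k² h₂²)⁻¹)ⁿ ≤ ((a₁² q + k² h₁²)⁻¹)ⁿ` (with the convention `0⁻¹ = 0`: if the smaller base
vanishes then `q = 0` and `k = 0`, so both bases vanish). [folklore] -/
theorem powerSums_term_antitone (q k a₁ h₁ a₂ h₂ : ℝ) (n : ℕ) (hq : 0 ≤ q) (ha₁ : 0 < a₁)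
    (ha : a₁ ≤ a₂) (hh₁ : 0 < h₁) (hh : h₁ ≤ h₂) :
    0 ≤ ((a₂ ^ 2 * q + k ^ 2 * h₂ ^ 2)⁻¹) ^ n ∧
      ((a₂ ^ 2 * q + k ^ 2 * h₂ ^ 2)⁻¹) ^ n ≤ ((a₁ ^ 2 * q + k ^ 2 * h₁ ^ 2)⁻¹) ^ n := by
  have ha2 : a₁ ^ 2 ≤ a₂ ^ 2 := pow_le_pow_left₀ ha₁.le ha 2
  have hh2 : h₁ ^ 2 ≤ h₂ ^ 2 := pow_le_pow_left₀ hh₁.le hh 2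
  have hk2 : 0 ≤ k ^ 2 := sq_nonneg k
  have hb₁ : 0 ≤ a₁ ^ 2 * q + k ^ 2 * h₁ ^ 2 :=
    add_nonneg (mul_nonneg (sq_nonneg _) hq) (mul_nonneg hk2 (sq_nonneg _))
  have hb₂ : 0 ≤ a₂ ^ 2 * q + k ^ 2 * h₂ ^ 2 :=
    add_nonneg (mul_nonneg (sq_nonneg _) hq) (mul_nonneg hk2 (sq_nonneg _))
  have hb : a₁ ^ 2 * q + k ^ 2 * h₁ ^ 2 ≤ a₂ ^ 2 * q + k ^ 2 * h₂ ^ 2 :=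
    add_le_add (mul_le_mul_of_nonneg_right ha2 hq) (mul_le_mul_of_nonneg_left hh2 hk2)
  have hinv : (a₂ ^ 2 * q + k ^ 2 * h₂ ^ 2)⁻¹ ≤ (a₁ ^ 2 * q + k ^ 2 * h₁ ^ 2)⁻¹ := by
    rcases hb₁.eq_or_lt with h0 | hpos
    · -- the smaller base vanishes: then `q = 0` and `k = 0`, so the larger base vanishes too
      have hqk := (add_eq_zero_iff_of_nonneg (mul_nonneg (sq_nonneg _) hq)
        (mul_nonneg hk2 (sq_nonneg _))).1 h0.symm
      have hq0 : q = 0 := by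
        rcases mul_eq_zero.1 hqk.1 with h | h
        · exact absurd h (pow_ne_zero 2 ha₁.ne')
        · exact h
      have hk0 : k ^ 2 = 0 := by
        rcases mul_eq_zero.1 hqk.2 with h | h
        · exact h
        · exact absurd h (pow_ne_zero 2 hh₁.ne')
      rw [← h0, hq0, hk0]
      simp
    · exact inv_anti₀ hpos hb
  exact ⟨pow_nonneg (inv_nonneg.2 hb₂) n, pow_le_pow_left₀ (inv_nonneg.2 hb₂) hinv n⟩

/-- N2 — THE POWER SERIES ARE ANTITONE IN THE PARAMETERS.  `Q v ≥ 0` for every `v` (`Q` is a squared planar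
norm: `i² + ij + j² = (i + j/2)² + 3j²/4`, `i² + ij + j² + i + j + 1/3 = (i + j/2 + 1/2)² + (3/4)(j + 1/3)²`),
so each term `[v ≠ 0]·((a²Q v + k²h²)⁻¹)ⁿ` decreases when `a` and `h` increase (`0 < a₁ ≤ a₂`, `0 < h₁ ≤ h₂`);
summability passes to the larger parameters by domination and `Summable.tsum_le_tsum` concludes. [folklore] -/
theorem stub_powerSums_antitone :
    ∀ (Q : ℤ × ℤ × ℤ → ℝ),
    (Q = fun v => (v.2.1 : ℝ) ^ 2 + (v.2.1 : ℝ) * v.2.2 + (v.2.2 : ℝ) ^ 2 +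
      (if Even v.1 then 0 else ((v.2.1 : ℝ) + v.2.2 + 1 / 3))) →
    ∀ (n : ℕ) (a₁ h₁ a₂ h₂ : ℝ), 0 < a₁ → a₁ ≤ a₂ → 0 < h₁ → h₁ ≤ h₂ →
      (Summable fun v : ℤ × ℤ × ℤ =>
        if v = 0 then (0 : ℝ) else ((a₁ ^ 2 * Q v + (v.1 : ℝ) ^ 2 * h₁ ^ 2)⁻¹) ^ n) →
      (Summable fun v : ℤ × ℤ × ℤ =>
        if v = 0 then (0 : ℝ) else ((a₂ ^ 2 * Q v + (v.1 : ℝ) ^ 2 * h₂ ^ 2)⁻¹) ^ n) ∧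
      (∑' v : ℤ × ℤ × ℤ,
          if v = 0 then (0 : ℝ) else ((a₂ ^ 2 * Q v + (v.1 : ℝ) ^ 2 * h₂ ^ 2)⁻¹) ^ n) ≤
        ∑' v : ℤ × ℤ × ℤ,
          if v = 0 then (0 : ℝ) else ((a₁ ^ 2 * Q v + (v.1 : ℝ) ^ 2 * h₁ ^ 2)⁻¹) ^ n := by
  intro Q hQ n a₁ h₁ a₂ h₂ ha₁ ha hh₁ hh hS
  have hQnn : ∀ v, 0 ≤ Q v := by
    intro v
    rw [hQ]
    exact Summit.AtomisticToContinuum.Crystallization.Theorems.ExcessDecayLiouvilleCoarseGrains.hcpPinC_Q_nonneg v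
  have hterm : ∀ v : ℤ × ℤ × ℤ,
      (0 ≤ (if v = 0 then (0 : ℝ) else ((a₂ ^ 2 * Q v + (v.1 : ℝ) ^ 2 * h₂ ^ 2)⁻¹) ^ n)) ∧
      ((if v = 0 then (0 : ℝ) else ((a₂ ^ 2 * Q v + (v.1 : ℝ) ^ 2 * h₂ ^ 2)⁻¹) ^ n) ≤
        (if v = 0 then (0 : ℝ) else ((a₁ ^ 2 * Q v + (v.1 : ℝ) ^ 2 * h₁ ^ 2)⁻¹) ^ n)) := by
    intro v
    split_ifs
    · exact ⟨le_rfl, le_rfl⟩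
    · exact powerSums_term_antitone (Q v) (v.1 : ℝ) a₁ h₁ a₂ h₂ n (hQnn v) ha₁ ha hh₁ hh
  have hS₂ : Summable fun v : ℤ × ℤ × ℤ =>
      if v = 0 then (0 : ℝ) else ((a₂ ^ 2 * Q v + (v.1 : ℝ) ^ 2 * h₂ ^ 2)⁻¹) ^ n :=
    Summable.of_nonneg_of_le (fun v => (hterm v).1) (fun v => (hterm v).2) hS
  exact ⟨hS₂, hS₂.tsum_le_tsum (fun v => (hterm v).2) hS⟩

end Summit.AtomisticToContinuum.Crystallization.Theorems.LjBilayerHcpSketch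

end
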